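import Summits.ValiantsHypothesis.ValiantsHypothesis.Theorems.CirculantFourierHrubesBridgeRep
import Summits.ValiantsHypothesis.ValiantsHypothesis.Theses.CirculantFourier

/-!
# Hrubeš's bridge (route `CirculantFourier`, item `HrubesBridge`): the theorem

Closes item `stmt-ValiantsHypothesis-6309`: `hrubesBridge_proof :
Summit.ValiantsHypothesis.ValiantsHypothesis.Theses.CirculantFourier.HrubesBridge` — Hrubeš 2020,
*On ε-sensitive monotone computations* (ECCC TR19-034; Comput. Complexity 29 (2020)), Thm. 1:
"Let `f ∈ ℝ[x_1, …, x_n]` be a polynomial of degree `d` which can be computed by an arithmetic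
circuit of size `s`. Then there exists `ε₀ > 0` such for every `0 < ε < ε₀`,
`(x_1 + ⋯ + x_n + 1)^d + εf` can be computed by a monotone arithmetic circuit of size
`O(sd² + n log n)`", rendered in the tree's models (`complexity` = least size of a fan-in-two
`ArithCircuit ℝ`; monotone = Jerrum–Snir plain circuits over `ℝ≥0`,
`Literature.Barriers.ValiantsHypothesis.IsMonotoneComputation`) with the polynomial overhead
`32 (L_ℝ(f) + n + d + 1)³` asked by the route (our one-pass simulation costs
`O(s (n + d²) + n + d)` gates; the `n log n` trick of the print is not needed for a cubic bound).

Assembly (`final_poly`): from the representation `(P_k, Q_k, c_k)_{k ≤ d}` of `f` (part B),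
`f = Σ_{k ≤ d} f^{(k)} = Σ_k (2P_k - c_k L^k)` and
`(1 + L)^d + εf = Σ_k (C(d,k) - ε c_k) L^k + 2ε Σ_k P_k`, a plain monotone expression as soon as
`ε c_k ≤ 1 ≤ C(d,k)`, i.e. for `ε < ε₀ := 1 / (1 + Σ_k c_k)`.
-/

noncomputable section

-- `Summit.ValiantsHypothesis.ValiantsHypothesis.…` is the tree's mandated layout (Sub = Summit).
set_option linter.dupNamespace false

namespace Summit.ValiantsHypothesis.ValiantsHypothesis.Theorems.CirculantFourierHrubes

open MvPolynomial Literature.Computability.AlgebraicComplexity ArithCircuit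
  Literature.Barriers.ValiantsHypothesis
open scoped NNReal

variable {σ : Type*}

/-- `Good[gs]` (local notation, not a definition): every gate of `gs` has fan-in `≤ 2` and is
plain. -/
local notation3 (prettyPrint := false) "Good[" gs "]" =>
  ∀ g ∈ (gs : List (Gate ℝ≥0 _)), Gate.fanIn g ≤ 2 ∧ IsPlainGate g

/-- `Av[gs, a]` (local notation, not a definition): some operand referring only to gates of `gs`
evaluates to `a` against the values of `gs`. -/
local notation3 (prettyPrint := false) "Av[" gs ", " a "]" =>
  ∃ u : Operand ℝ≥0 _, Operand.RefsBelow (List.length gs) u ∧ Operand.eval (gateValues gs) u = a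

/-- `Rep[gs, d, w]` (local notation, not a definition): the real polynomial `w` is *represented*
after the gates `gs` up to degree `d` — for every `k ≤ d` there are available polynomials
`P_k, Q_k` over `ℝ≥0` with `P_k - Q_k = w^{(k)}` (the degree-`k` homogeneous component) and
`P_k + Q_k = c_k · (Σ_i x_i)^k`. -/
local notation3 (prettyPrint := false) "Rep[" gs ", " d ", " w "]" =>
  ∃ (P Q : ℕ → MvPolynomial _ ℝ≥0) (c : ℕ → ℝ≥0), ∀ k ≤ (d : ℕ),
    Av[gs, P k] ∧ Av[gs, Q k] ∧
    MvPolynomial.map NNReal.toRealHom (P k) - MvPolynomial.map NNReal.toRealHom (Q k) =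
      MvPolynomial.homogeneousComponent k w ∧
    P k + Q k = c k • (∑ i, MvPolynomial.X i) ^ k

section Final

variable [Fintype σ] [DecidableEq σ]

/-- **The monotone normal form.** Given available `P_k, Q_k` (`k ≤ d`) with
`P_k - Q_k = f^{(k)}` and `P_k + Q_k = c_k L^k` (`L = Σ_i x_i`, `deg f ≤ d`) and `ε > 0` with
`ε c_k ≤ 1`, the polynomial `g = Σ_{k ≤ d} (C(d,k) - ε c_k) L^k + 2ε Σ_{k ≤ d} P_k` over `ℝ≥0` is
available after `≤ #σ + 3(d+1) + d + 2` more gates and maps to `(1 + L)^d + ε f`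
(Hrubeš 2020, proof of Thm. 1: `U + εf = Σ_k (C(d,k) - εR_k) L^k + ε Σ_k h_k + ε f₊`). -/
theorem final_poly {gs : List (Gate ℝ≥0 σ)} (hgs : Good[gs]) {d : ℕ} {f : MvPolynomial σ ℝ}
    (hf : f.totalDegree ≤ d) (P Q : ℕ → MvPolynomial σ ℝ≥0) (c : ℕ → ℝ≥0)
    (hrep : ∀ k ≤ d, Av[gs, P k] ∧ Av[gs, Q k] ∧
      MvPolynomial.map NNReal.toRealHom (P k) - MvPolynomial.map NNReal.toRealHom (Q k) =
        MvPolynomial.homogeneousComponent k f ∧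
      P k + Q k = c k • (∑ i, MvPolynomial.X i) ^ k)
    {ε : ℝ} (hε : 0 < ε) (hεc : ∀ k ≤ d, ε * (c k : ℝ) ≤ 1) :
    ∃ (g : MvPolynomial σ ℝ≥0) (R : ArithCircuit ℝ≥0 σ),
      MvPolynomial.map NNReal.toRealHom g = (1 + ∑ i, X i) ^ d + C ε * f ∧
      IsMonotoneComputation R g ∧
      R.size ≤ gs.length + (Fintype.card σ + 3 * (d + 1) + d + 2) := by
  set L : MvPolynomial σ ℝ≥0 := ∑ i, X i with hL
  have hmapL : MvPolynomial.map NNReal.toRealHom L = ∑ i, (X i : MvPolynomial σ ℝ) := by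
    simp only [hL, map_sum, map_X]
  have hεcoe : ((Real.toNNReal ε : ℝ≥0) : ℝ) = ε := Real.coe_toNNReal ε hε.le
  -- the gates
  obtain ⟨gs₁, hg₁, hl₁, hL₁⟩ := ext_sum Finset.univ (fun i => (X i : MvPolynomial σ ℝ≥0)) gs hgs
    (fun i _ => av_X gs i)
  obtain ⟨gs₂, hg₂, hl₂, hpow⟩ := ext_pow hg₁ hL₁ d
  obtain ⟨gs₃, hg₃, hl₃, -, hterm⟩ := ext_family hg₂ d 1 (fun gs' => ∀ k ≤ d, Av[gs', L ^ k])
    (fun gs' gs'' h k hk => av_mono gs'' (h k hk)) hpow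
    (fun k => C ((d.choose k : ℝ≥0) - Real.toNNReal ε * c k) * L ^ k)
    (fun gs' hg' hA' k hk => ext_mul hg' (av_C _ _) (hA' k hk))
  obtain ⟨gs₄, hg₄, hl₄, hU⟩ := ext_sum (Finset.range (d + 1))
    (fun k => C ((d.choose k : ℝ≥0) - Real.toNNReal ε * c k) * L ^ k) _ hg₃
    (fun k hk => hterm k (by have := Finset.mem_range.mp hk; omega))
  have hPav : ∀ k ∈ Finset.range (d + 1), Av[gs ++ gs₁ ++ gs₂ ++ gs₃ ++ gs₄, P k] := by
    intro k hk
    have hk' : k ≤ d := by have := Finset.mem_range.mp hk; omega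
    simpa only [List.append_assoc] using av_mono (gs₁ ++ gs₂ ++ gs₃ ++ gs₄) (hrep k hk').1
  obtain ⟨gs₅, hg₅, hl₅, hSP⟩ := ext_sum (Finset.range (d + 1)) (fun k => P k) _ hg₄ hPav
  obtain ⟨gs₆, hg₆, hl₆, hE⟩ := ext_mul hg₅ (av_C _ (2 * Real.toNNReal ε)) hSP
  obtain ⟨gs₇, hg₇, hl₇, hG⟩ := ext_add hg₆ (av_mono gs₆ (av_mono gs₅ hU)) hE
  obtain ⟨R, hR, hRsize⟩ := extract hg₇ hG
  refine ⟨_, R, ?_, hR, ?_⟩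
  · -- the identity `map g = (1 + L)^d + ε f`
    have hf' : ∑ k ∈ Finset.range (d + 1), homogeneousComponent k f = f :=
      sum_homogeneousComponent_of_lt f (by omega)
    have hUr : (1 + ∑ i, (X i : MvPolynomial σ ℝ)) ^ d =
        ∑ k ∈ Finset.range (d + 1),
          (∑ i, (X i : MvPolynomial σ ℝ)) ^ k * (d.choose k : MvPolynomial σ ℝ) := by
      rw [add_comm, add_pow]
      simp only [one_pow, mul_one]
    have h2 : NNReal.toRealHom (2 * Real.toNNReal ε) = 2 * ε := by
      show ((2 * Real.toNNReal ε : ℝ≥0) : ℝ) = 2 * ε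
      push_cast [hεcoe]; ring
    have hterm : ∀ k ≤ d,
        MvPolynomial.map NNReal.toRealHom
            (C ((d.choose k : ℝ≥0) - Real.toNNReal ε * c k) * L ^ k) +
          C (2 * ε) * MvPolynomial.map NNReal.toRealHom (P k) =
        (∑ i, (X i : MvPolynomial σ ℝ)) ^ k * (d.choose k : MvPolynomial σ ℝ) +
          C ε * homogeneousComponent k f := by
      intro k hk
      obtain ⟨-, -, e, s⟩ := hrep k hk
      have hQ : MvPolynomial.map NNReal.toRealHom (Q k) =
          C (c k : ℝ) * (∑ i, (X i : MvPolynomial σ ℝ)) ^ k -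
            MvPolynomial.map NNReal.toRealHom (P k) := by
        have h := congrArg (MvPolynomial.map NNReal.toRealHom) s
        rw [map_add, smul_eq_C_mul, map_mul, map_C, map_pow, hmapL] at h
        simp only [NNReal.coe_toRealHom] at h
        linear_combination h
      have hle : Real.toNNReal ε * c k ≤ (d.choose k : ℝ≥0) := by
        rw [← NNReal.coe_le_coe, NNReal.coe_mul, hεcoe, NNReal.coe_natCast]
        exact (hεc k hk).trans (by exact_mod_cast Nat.choose_pos hk)
      have hcoef : NNReal.toRealHom ((d.choose k : ℝ≥0) - Real.toNNReal ε * c k) =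
          (d.choose k : ℝ) - ε * (c k : ℝ) := by
        show (((d.choose k : ℝ≥0) - Real.toNNReal ε * c k : ℝ≥0) : ℝ) = _
        rw [NNReal.coe_sub hle, NNReal.coe_mul, hεcoe, NNReal.coe_natCast]
      rw [map_mul, map_C, map_pow, hmapL, ← e, hQ, hcoef, C_sub, C_mul, C_mul]
      simp only [map_natCast, map_ofNat]
      ring
    calc MvPolynomial.map NNReal.toRealHom
          ((∑ k ∈ Finset.range (d + 1), C ((d.choose k : ℝ≥0) - Real.toNNReal ε * c k) * L ^ k) +
            C (2 * Real.toNNReal ε) * ∑ k ∈ Finset.range (d + 1), P k)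
        = ∑ k ∈ Finset.range (d + 1),
            (MvPolynomial.map NNReal.toRealHom
                (C ((d.choose k : ℝ≥0) - Real.toNNReal ε * c k) * L ^ k) +
              C (2 * ε) * MvPolynomial.map NNReal.toRealHom (P k)) := by
          rw [map_add, map_sum, map_mul, map_C, map_sum, h2, Finset.mul_sum,
            ← Finset.sum_add_distrib]
      _ = ∑ k ∈ Finset.range (d + 1),
            ((∑ i, (X i : MvPolynomial σ ℝ)) ^ k * (d.choose k : MvPolynomial σ ℝ) +
              C ε * homogeneousComponent k f) :=
          Finset.sum_congr rfl fun k hk => hterm k (by have := Finset.mem_range.mp hk; omega)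
      _ = (1 + ∑ i, X i) ^ d + C ε * f := by
          rw [Finset.sum_add_distrib, ← Finset.mul_sum, hf', ← hUr]
  · -- the size
    rw [hRsize]
    simp only [List.length_append]
    rw [Finset.card_univ] at hl₁
    rw [Finset.card_range] at hl₄ hl₅
    omega

omit [DecidableEq σ] in
/-- The arithmetic of the size bound: `s · 2(n + 2 + 8(d+1)²) + (n + 2) + (n + 3(d+1) + d + 2)
≤ 32 (s + n + d + 1)³`. -/
theorem size_arith (s n d : ℕ) :
    s * (2 * (n + 2 + 8 * (d + 1) ^ 2)) + (n + 2) + (n + 3 * (d + 1) + d + 2) ≤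
      32 * (s + n + d + 1) ^ 3 := by
  have hN1 : 1 ≤ s + n + d + 1 := by omega
  have hn : n ≤ s + n + d + 1 := by omega
  have hs : s ≤ s + n + d + 1 := by omega
  have hd2 : (d + 1) ^ 2 ≤ (s + n + d + 1) ^ 2 := Nat.pow_le_pow_left (by omega) 2
  have hNN : s + n + d + 1 ≤ (s + n + d + 1) ^ 2 := by nlinarith
  have h1 : n + 2 + 8 * (d + 1) ^ 2 ≤ 11 * (s + n + d + 1) ^ 2 := by nlinarith
  have h2 : s * (2 * (n + 2 + 8 * (d + 1) ^ 2)) ≤ 22 * (s + n + d + 1) ^ 3 :=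
    calc s * (2 * (n + 2 + 8 * (d + 1) ^ 2))
        ≤ (s + n + d + 1) * (2 * (11 * (s + n + d + 1) ^ 2)) :=
          Nat.mul_le_mul hs (Nat.mul_le_mul_left 2 h1)
      _ = 22 * (s + n + d + 1) ^ 3 := by ring
  have h3 : (n + 2) + (n + 3 * (d + 1) + d + 2) ≤ 7 * (s + n + d + 1) := by omega
  have h4 : 7 * (s + n + d + 1) ≤ 7 * (s + n + d + 1) ^ 3 :=
    Nat.mul_le_mul_left 7 (Nat.le_self_pow three_ne_zero _)
  linarith

end Final

/-- **Hrubeš's bridge** (Hrubeš 2020, *On ε-sensitive monotone computations*, Thm. 1), in the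
tree's models: with `C = 32`, for every real polynomial `f` in `n` variables of degree `≤ d` there
is `ε₀ > 0` such that for all `0 < ε < ε₀` the polynomial `(1 + Σ_i x_i)^d + ε f` is the image of a
polynomial over `ℝ≥0` computed by a plain fan-in-two monotone circuit (Jerrum–Snir model,
`IsMonotoneComputation`) of size `≤ C (L_ℝ(f) + n + d + 1)^3`.

Proof: one pass over a size-optimal fan-in-two circuit for `f`
(`ArithCircuit.exists_computes_size_eq_complexity`), maintaining for every gate value `w` and
every `k ≤ d` plain-computable `P_k, Q_k ∈ ℝ≥0[x]` with `P_k - Q_k = w^{(k)}` and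
`P_k + Q_k = c_k (Σ x_i)^k` (`rep_gates`; negation swaps `P` and `Q`, products convolve); then
`(1 + L)^d + εf = Σ_k (C(d,k) - ε c_k) L^k + 2ε Σ_k P_k` for `ε < 1 / (1 + Σ_k c_k)` (`final_poly`).
This closes item `stmt-ValiantsHypothesis-6309` of route `CirculantFourier`. -/
theorem hrubesBridge_proof :
    Summit.ValiantsHypothesis.ValiantsHypothesis.Theses.CirculantFourier.HrubesBridge := by
  refine ⟨32, fun n d f hf => ?_⟩
  classical
  obtain ⟨P₀, hfan, hcomp, hsize⟩ := ArithCircuit.exists_computes_size_eq_complexity f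
  obtain ⟨gs, hgs, hlen, hrep⟩ := rep_gates (σ := Fin n) d P₀.gates hfan
  obtain ⟨gs₁, hg₁, hl₁, hrf⟩ := rep_operand hgs d (gateValues P₀.gates) hrep P₀.output
  have hcomp' : P₀.output.eval (gateValues P₀.gates) = f := hcomp
  rw [hcomp'] at hrf
  obtain ⟨P, Q, c, hPQ⟩ := hrf
  have hS : 0 ≤ ∑ k ∈ Finset.range (d + 1), (c k : ℝ) :=
    Finset.sum_nonneg fun k _ => (c k).coe_nonneg
  refine ⟨1 / (1 + ∑ k ∈ Finset.range (d + 1), (c k : ℝ)), div_pos one_pos (by linarith),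
    fun ε hε hεlt => ?_⟩
  have hεc : ∀ k ≤ d, ε * (c k : ℝ) ≤ 1 := by
    intro k hk
    have hck : (c k : ℝ) ≤ ∑ k ∈ Finset.range (d + 1), (c k : ℝ) :=
      Finset.single_le_sum (f := fun k => (c k : ℝ)) (fun k _ => (c k).coe_nonneg)
        (Finset.mem_range.mpr (by omega))
    have h1 : ε * (1 + ∑ k ∈ Finset.range (d + 1), (c k : ℝ)) < 1 := by
      rwa [lt_div_iff₀ (by linarith)] at hεlt
    nlinarith [mul_nonneg hε.le (sub_nonneg.mpr hck)]
  obtain ⟨g, R, hg, hR, hRsize⟩ := final_poly hg₁ hf P Q c hPQ hε hεc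
  refine ⟨g, R, hg, hR, ?_⟩
  have hgl : P₀.gates.length = complexity f := hsize
  rw [List.length_append] at hRsize
  simp only [Fintype.card_fin] at hlen hl₁ hRsize
  rw [hgl] at hlen
  calc R.size ≤ gs.length + gs₁.length + (n + 3 * (d + 1) + d + 2) := hRsize
    _ ≤ complexity f * (2 * (n + 2 + 8 * (d + 1) ^ 2)) + (n + 2) + (n + 3 * (d + 1) + d + 2) :=
        Nat.add_le_add_right (Nat.add_le_add hlen hl₁) _
    _ ≤ 32 * (complexity f + n + d + 1) ^ 3 := size_arith _ _ _

end Summit.ValiantsHypothesis.ValiantsHypothesis.Theorems.CirculantFourierHrubes
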